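import Summits.CriticalPhenomena.PercolationContinuityZ3.Theorems.PercNearOneGluingNoHeavyLowerTailGZHubBoundedHub
import HarnessLib

/-!
# `NoHeavyLowerTail` (stmt-CriticalPhenomena-4575) — support file: Gladkov–Zimin Conjecture 6.3 in its printed
# COVARIANCE form for hubs of bounded isolation probability (prover `prim-ineq-prove-2` gen 8, MEMO-17)

No definitions, no named facts, no sorries.  Sequel of `PercNearOneGluingNoHeavyLowerTailGZHubBoundedHub.lean`.
With `β_c = ∏_{v ≠ c} (1 − w(cv)) = P(no open edge at c)`:

* `beta_mul_avoidAttached_le`: `β_c · μ(a↔c↔b ∧ a ↔ b off c) ≤ (1 − β_c) · μ(ab|c)` (on `{a ↔ b off c}` the hub is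
  attached with probability `≤ 1 − β_c` and unattached with probability `≥ β_c`, independently);
* `gz_cov_boundedHub`: **`β_c · (P(a↔c↔b) − P(a↔c)·P(b↔c)) ≤ P(ab|c)`**, i.e. `Cov(1{a↔c},1{b↔c}) ≤ P(ab|c)/P(c isolated)`
  on every finite weighted graph — the printed Gladkov–Zimin Conjecture 6.3 ("for any `ε > 0` there exists `δ > 0` such
  that if `P(ab|c) < δ`, then `P(abc) − P(ac)P(bc) < ε`", arXiv:2404.08873 §6; = Gladkov arXiv:2408.08457 Conj. 10.1)
  with `δ = ε·P(c isolated)` (`gz_conj63_of_hubIsolation`: the printed `ε–δ` form on every class `P(c isolated) ≥ β₀`);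
  the hub-uniform statement remains open.

Proof: THEOREM B in the form `x·s − u_a·u_b ≤ θ₁·s` (`GZHub.gz_defect_le_avoid_mul_apart`), the five-cell identity
`Cov = x·s − u_a·u_b + x·w`, and `β_c·θ₁ ≤ (1 − β_c)·w`.
-/

noncomputable section

namespace Summit.CriticalPhenomena.PercolationContinuityZ3.Theorems

open MeasureTheory Finset Literature.Probability.LatticeModels Literature.Probability.Percolation
open Literature.Probability.Percolation.BHK2006 (openGraph_le)
open scoped Classical

namespace GZHub

variable {V : Type*} [Fintype V]

/-! ### The covariance form: `P(c isolated) · Cov(1{a↔c},1{b↔c}) ≤ P(ab|c)` -/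

/-- `β_c · θ₁ ≤ (1 − β_c) · P(ab|c)`: on `J = {a ↔ b off c}` the hub is attached with probability at most `1 − β_c` and
unattached with probability at least `β_c`, independently of `J` (`θ₁ = μ(abc ∩ J)`, `β_c = ∏_{v≠c}(1 − w(cv))`). [folklore] -/
theorem beta_mul_avoidAttached_le (w : Sym2 V → unitInterval) {a b c : V} (hac : a ≠ c) :
    (∏ v ∈ univ.filter (fun v => v ≠ c), (1 - (w s(c, v) : ℝ))) * (prodBernoulli w).real (((openConn a c : Set (Set (Sym2 V))) ∩ (openConn b c : Set (Set (Sym2 V)))) ∩ {ω : Set (Sym2 V) | (openGraph (ω \ {e : Sym2 V | c ∈ e})).Reachable a b}) ≤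
      (1 - (∏ v ∈ univ.filter (fun v => v ≠ c), (1 - (w s(c, v) : ℝ)))) * (prodBernoulli w).real ((openConn a b : Set (Set (Sym2 V))) ∩ ((openConn a c : Set (Set (Sym2 V))))ᶜ) := by
  have hm : ∀ S : Set (Set (Sym2 V)), MeasurableSet S := fun S => MeasurableSet.of_discrete
  have hclosed : (prodBernoulli w).real {ω : Set (Sym2 V) | ∀ v ∈ univ.filter (fun v => v ≠ c), s(c, v) ∉ ω} = (∏ v ∈ univ.filter (fun v => v ≠ c), (1 - (w s(c, v) : ℝ))) := by
    have h := real_hit w c (univ.filter (fun v => v ≠ c))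
    have hc : {ω : Set (Sym2 V) | ∀ v ∈ univ.filter (fun v => v ≠ c), s(c, v) ∉ ω} = ({η : Set (Sym2 V) | ∃ v ∈ univ.filter (fun v => v ≠ c), s(c, v) ∈ η})ᶜ := by
      ext ω; simp only [Set.mem_setOf_eq, Set.mem_compl_iff, not_exists, not_and]
    rw [hc, probReal_compl_eq_one_sub (hm _), h]
    ring
  have hJdet : DeterminedBy {ω : Set (Sym2 V) | (openGraph (ω \ {e : Sym2 V | c ∈ e})).Reachable a b}
      (↑((univ.filter (fun v => v ≠ c)).image fun v => s(c, v)) : Set (Sym2 V))ᶜ := by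
    rw [determinedBy_iff]
    intro ω ω' h
    have hωω' : ω \ {e : Sym2 V | c ∈ e} = ω' \ {e : Sym2 V | c ∈ e} := by
      ext e
      constructor
      · rintro ⟨he, hce⟩
        have : e ∈ ω ∩ (↑((univ.filter (fun v => v ≠ c)).image fun v => s(c, v)) : Set (Sym2 V))ᶜ := by
          refine ⟨he, fun hF => hce ?_⟩
          obtain ⟨v, -, rfl⟩ := Finset.mem_image.1 (Finset.mem_coe.1 hF)
          exact Sym2.mem_mk_left c v
        rw [h] at this
        exact ⟨this.1, hce⟩
      · rintro ⟨he, hce⟩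
        have : e ∈ ω' ∩ (↑((univ.filter (fun v => v ≠ c)).image fun v => s(c, v)) : Set (Sym2 V))ᶜ := by
          refine ⟨he, fun hF => hce ?_⟩
          obtain ⟨v, -, rfl⟩ := Finset.mem_image.1 (Finset.mem_coe.1 hF)
          exact Sym2.mem_mk_left c v
        rw [← h] at this
        exact ⟨this.1, hce⟩
    simp only [Set.mem_setOf_eq, hωω']
  have hCdet : DeterminedBy {ω : Set (Sym2 V) | ∀ v ∈ univ.filter (fun v => v ≠ c), s(c, v) ∉ ω}
      (↑((univ.filter (fun v => v ≠ c)).image fun v => s(c, v)) : Set (Sym2 V)) := by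
    rw [determinedBy_iff]
    intro ω ω' h
    simp only [Set.mem_setOf_eq]
    constructor
    · intro hω v hv hω'
      have : s(c, v) ∈ ω' ∩ ↑((univ.filter (fun v => v ≠ c)).image fun v => s(c, v)) :=
        ⟨hω', Finset.mem_coe.2 (Finset.mem_image.2 ⟨v, hv, rfl⟩)⟩
      rw [← h] at this
      exact hω v hv this.1
    · intro hω' v hv hω
      have : s(c, v) ∈ ω ∩ ↑((univ.filter (fun v => v ≠ c)).image fun v => s(c, v)) :=
        ⟨hω, Finset.mem_coe.2 (Finset.mem_image.2 ⟨v, hv, rfl⟩)⟩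
      rw [h] at this
      exact hω' v hv this.1
  have hindep : (prodBernoulli w).real ({ω : Set (Sym2 V) | ∀ v ∈ univ.filter (fun v => v ≠ c), s(c, v) ∉ ω} ∩ {ω : Set (Sym2 V) | (openGraph (ω \ {e : Sym2 V | c ∈ e})).Reachable a b}) =
      (∏ v ∈ univ.filter (fun v => v ≠ c), (1 - (w s(c, v) : ℝ))) * (prodBernoulli w).real {ω : Set (Sym2 V) | (openGraph (ω \ {e : Sym2 V | c ∈ e})).Reachable a b} := by
    rw [prodBernoulli_real_inter_of_determinedBy w _ hCdet hJdet (hm _) (hm _), hclosed]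
  have hw : (∏ v ∈ univ.filter (fun v => v ≠ c), (1 - (w s(c, v) : ℝ))) * (prodBernoulli w).real {ω : Set (Sym2 V) | (openGraph (ω \ {e : Sym2 V | c ∈ e})).Reachable a b} ≤ (prodBernoulli w).real ((openConn a b : Set (Set (Sym2 V))) ∩ ((openConn a c : Set (Set (Sym2 V))))ᶜ) := by
    rw [← hindep]
    refine measureReal_mono (fun ω hω => ?_)
    refine ⟨hω.2.mono (openGraph_le Set.sdiff_subset), fun h => ?_⟩
    obtain ⟨v, hvc, hv⟩ := exists_open_hubEdge hac h
    exact hω.1 v (Finset.mem_filter.2 ⟨Finset.mem_univ v, hvc⟩) hv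
  have hθ : (prodBernoulli w).real (((openConn a c : Set (Set (Sym2 V))) ∩ (openConn b c : Set (Set (Sym2 V)))) ∩ {ω : Set (Sym2 V) | (openGraph (ω \ {e : Sym2 V | c ∈ e})).Reachable a b}) ≤ (1 - (∏ v ∈ univ.filter (fun v => v ≠ c), (1 - (w s(c, v) : ℝ)))) * (prodBernoulli w).real {ω : Set (Sym2 V) | (openGraph (ω \ {e : Sym2 V | c ∈ e})).Reachable a b} := by
    have hsplit := measureReal_inter_add_sdiff (μ := prodBernoulli w) (s := {ω : Set (Sym2 V) | (openGraph (ω \ {e : Sym2 V | c ∈ e})).Reachable a b}) (hm {ω : Set (Sym2 V) | ∀ v ∈ univ.filter (fun v => v ≠ c), s(c, v) ∉ ω})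
    have hmono : (prodBernoulli w).real (((openConn a c : Set (Set (Sym2 V))) ∩ (openConn b c : Set (Set (Sym2 V)))) ∩ {ω : Set (Sym2 V) | (openGraph (ω \ {e : Sym2 V | c ∈ e})).Reachable a b}) ≤ (prodBernoulli w).real ({ω : Set (Sym2 V) | (openGraph (ω \ {e : Sym2 V | c ∈ e})).Reachable a b} \ {ω : Set (Sym2 V) | ∀ v ∈ univ.filter (fun v => v ≠ c), s(c, v) ∉ ω}) := by
      refine measureReal_mono (fun ω hω => ⟨hω.2, fun hcl => ?_⟩)
      obtain ⟨v, hvc, hv⟩ := exists_open_hubEdge hac hω.1.1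
      exact hcl v (Finset.mem_filter.2 ⟨Finset.mem_univ v, hvc⟩) hv
    rw [Set.inter_comm] at hindep
    nlinarith [hmono, hsplit, hindep]
  have hβ0 : 0 ≤ (∏ v ∈ univ.filter (fun v => v ≠ c), (1 - (w s(c, v) : ℝ))) := Finset.prod_nonneg fun v _ => sub_nonneg.2 (w s(c, v)).2.2
  calc (∏ v ∈ univ.filter (fun v => v ≠ c), (1 - (w s(c, v) : ℝ))) * (prodBernoulli w).real (((openConn a c : Set (Set (Sym2 V))) ∩ (openConn b c : Set (Set (Sym2 V)))) ∩ {ω : Set (Sym2 V) | (openGraph (ω \ {e : Sym2 V | c ∈ e})).Reachable a b})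
      ≤ (∏ v ∈ univ.filter (fun v => v ≠ c), (1 - (w s(c, v) : ℝ))) * ((1 - (∏ v ∈ univ.filter (fun v => v ≠ c), (1 - (w s(c, v) : ℝ)))) * (prodBernoulli w).real {ω : Set (Sym2 V) | (openGraph (ω \ {e : Sym2 V | c ∈ e})).Reachable a b}) := mul_le_mul_of_nonneg_left hθ hβ0
    _ = (1 - (∏ v ∈ univ.filter (fun v => v ≠ c), (1 - (w s(c, v) : ℝ)))) * ((∏ v ∈ univ.filter (fun v => v ≠ c), (1 - (w s(c, v) : ℝ))) * (prodBernoulli w).real {ω : Set (Sym2 V) | (openGraph (ω \ {e : Sym2 V | c ∈ e})).Reachable a b}) := by ring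
    _ ≤ (1 - (∏ v ∈ univ.filter (fun v => v ≠ c), (1 - (w s(c, v) : ℝ)))) * (prodBernoulli w).real ((openConn a b : Set (Set (Sym2 V))) ∩ ((openConn a c : Set (Set (Sym2 V))))ᶜ) :=
        mul_le_mul_of_nonneg_left hw (sub_nonneg.2 (Finset.prod_le_one
          (fun v _ => sub_nonneg.2 (w s(c, v)).2.2) fun v _ => sub_le_self _ (w s(c, v)).2.1))

/-- **Gladkov–Zimin Conjecture 6.3, covariance form, for hubs of bounded isolation probability:**
`P(c isolated) · (P(a↔c↔b) − P(a↔c)·P(b↔c)) ≤ P(ab|c)` on every finite weighted graph, i.e.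
`Cov(1{a↔c}, 1{b↔c}) ≤ P(a ↔ b, c ∉ C(a)) / ∏_{v ≠ c} (1 − w(cv))`.  Printed conjecture (open in general): "For any
`ε > 0` there exists `δ > 0` such that if `P(ab|c) < δ`, then `P(abc) − P(ac)P(bc) < ε`" [Gladkov–Zimin 2404.08873,
Conj. 6.3] — here with `δ = ε · P(c isolated)`.  (prim-ineq-prove-2 MEMO-17: THEOREM B + the five-cell identity
`Cov = x·s − u_a·u_b + x·w`.) [cite: VandenbergHaggstromKahn2005, Thm. 1.4 (p. 7)] -/
theorem gz_cov_boundedHub (w : Sym2 V → unitInterval) {a b c : V} (hab : a ≠ b) (hac : a ≠ c) (hbc : b ≠ c) :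
    (∏ v ∈ univ.filter (fun v => v ≠ c), (1 - (w s(c, v) : ℝ))) *
        ((prodBernoulli w).real ((openConn a c : Set (Set (Sym2 V))) ∩ (openConn b c : Set (Set (Sym2 V)))) - (prodBernoulli w).real (openConn a c : Set (Set (Sym2 V))) * (prodBernoulli w).real (openConn b c : Set (Set (Sym2 V)))) ≤
      (prodBernoulli w).real ((openConn a b : Set (Set (Sym2 V))) ∩ ((openConn a c : Set (Set (Sym2 V))))ᶜ) := by
  have hm : ∀ S : Set (Set (Sym2 V)), MeasurableSet S := fun S => MeasurableSet.of_discrete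
  have hT := gz_defect_le_avoid_mul_apart w hab hac hbc
  have hK := beta_mul_avoidAttached_le w (b := b) hac
  -- the five-cell identities
  have e1 : (prodBernoulli w).real (openConn a c : Set (Set (Sym2 V))) =
      (prodBernoulli w).real ((openConn a c : Set (Set (Sym2 V))) ∩ (openConn b c : Set (Set (Sym2 V)))) + (prodBernoulli w).real ((openConn a c : Set (Set (Sym2 V))) ∩ ((openConn b c : Set (Set (Sym2 V))))ᶜ) := by
    rw [← measureReal_inter_add_sdiff (μ := prodBernoulli w) (s := (openConn a c : Set (Set (Sym2 V)))) (hm (openConn b c : Set (Set (Sym2 V)))), Set.sdiff_eq]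
  have e2 : (prodBernoulli w).real (openConn b c : Set (Set (Sym2 V))) =
      (prodBernoulli w).real ((openConn a c : Set (Set (Sym2 V))) ∩ (openConn b c : Set (Set (Sym2 V)))) + (prodBernoulli w).real ((openConn b c : Set (Set (Sym2 V))) ∩ ((openConn a c : Set (Set (Sym2 V))))ᶜ) := by
    rw [← measureReal_inter_add_sdiff (μ := prodBernoulli w) (s := (openConn b c : Set (Set (Sym2 V)))) (hm (openConn a c : Set (Set (Sym2 V)))), Set.sdiff_eq, Set.inter_comm]
  have e3 : (prodBernoulli w).real (((openConn a c : Set (Set (Sym2 V))))ᶜ ∩ ((openConn b c : Set (Set (Sym2 V))))ᶜ) =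
      (prodBernoulli w).real ((openConn a b : Set (Set (Sym2 V))) ∩ ((openConn a c : Set (Set (Sym2 V))))ᶜ) + (prodBernoulli w).real (((openConn a b : Set (Set (Sym2 V))))ᶜ ∩ ((openConn a c : Set (Set (Sym2 V))))ᶜ ∩ ((openConn b c : Set (Set (Sym2 V))))ᶜ) := by
    rw [← measureReal_inter_add_sdiff (μ := prodBernoulli w) (s := ((openConn a c : Set (Set (Sym2 V))))ᶜ ∩ ((openConn b c : Set (Set (Sym2 V))))ᶜ) (hm (openConn a b : Set (Set (Sym2 V))))]
    congr 2
    · ext ω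
      simp only [Set.mem_inter_iff, Set.mem_compl_iff]
      constructor
      · rintro ⟨⟨h1, -⟩, h3⟩; exact ⟨h3, h1⟩
      · rintro ⟨h3, h1⟩
        exact ⟨⟨h1, fun h2 => h1 (SimpleGraph.Reachable.trans h3 h2)⟩, h3⟩
    · ext ω
      simp only [Set.mem_sdiff, Set.mem_inter_iff, Set.mem_compl_iff]
      tauto
  have e4 : (prodBernoulli w).real (((openConn a c : Set (Set (Sym2 V))))ᶜ ∩ ((openConn b c : Set (Set (Sym2 V))))ᶜ) =
      1 - (prodBernoulli w).real (openConn a c : Set (Set (Sym2 V))) - (prodBernoulli w).real ((openConn b c : Set (Set (Sym2 V))) ∩ ((openConn a c : Set (Set (Sym2 V))))ᶜ) := by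
    have h1 := probReal_compl_eq_one_sub (μ := prodBernoulli w) (hm (openConn a c : Set (Set (Sym2 V))))
    have h2 := measureReal_inter_add_sdiff (μ := prodBernoulli w) (s := ((openConn a c : Set (Set (Sym2 V))))ᶜ) (hm (openConn b c : Set (Set (Sym2 V))))
    rw [Set.sdiff_eq, Set.inter_comm (((openConn a c : Set (Set (Sym2 V))))ᶜ) (openConn b c : Set (Set (Sym2 V)))] at h2
    linarith
  -- bounds
  have hβ0 : 0 ≤ (∏ v ∈ univ.filter (fun v => v ≠ c), (1 - (w s(c, v) : ℝ))) := Finset.prod_nonneg fun v _ => sub_nonneg.2 (w s(c, v)).2.2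
  have hβ1 : (∏ v ∈ univ.filter (fun v => v ≠ c), (1 - (w s(c, v) : ℝ))) ≤ 1 :=
    Finset.prod_le_one (fun v _ => sub_nonneg.2 (w s(c, v)).2.2) fun v _ => sub_le_self _ (w s(c, v)).2.1
  have hs1 : (prodBernoulli w).real (((openConn a b : Set (Set (Sym2 V))))ᶜ ∩ ((openConn a c : Set (Set (Sym2 V))))ᶜ ∩ ((openConn b c : Set (Set (Sym2 V))))ᶜ) ≤ 1 := measureReal_le_one
  have hs0 : 0 ≤ (prodBernoulli w).real (((openConn a b : Set (Set (Sym2 V))))ᶜ ∩ ((openConn a c : Set (Set (Sym2 V))))ᶜ ∩ ((openConn b c : Set (Set (Sym2 V))))ᶜ) := measureReal_nonneg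
  have hx1 : (prodBernoulli w).real ((openConn a c : Set (Set (Sym2 V))) ∩ (openConn b c : Set (Set (Sym2 V)))) ≤ 1 := measureReal_le_one
  have hx0 : 0 ≤ (prodBernoulli w).real ((openConn a c : Set (Set (Sym2 V))) ∩ (openConn b c : Set (Set (Sym2 V)))) := measureReal_nonneg
  have hθ0 : 0 ≤ (prodBernoulli w).real (((openConn a c : Set (Set (Sym2 V))) ∩ (openConn b c : Set (Set (Sym2 V)))) ∩ {ω : Set (Sym2 V) | (openGraph (ω \ {e : Sym2 V | c ∈ e})).Reachable a b}) := measureReal_nonneg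
  have hw0 : 0 ≤ (prodBernoulli w).real ((openConn a b : Set (Set (Sym2 V))) ∩ ((openConn a c : Set (Set (Sym2 V))))ᶜ) := measureReal_nonneg
  -- Cov = (x s − u_b u_a) + x w
  have hcov : (prodBernoulli w).real ((openConn a c : Set (Set (Sym2 V))) ∩ (openConn b c : Set (Set (Sym2 V)))) - (prodBernoulli w).real (openConn a c : Set (Set (Sym2 V))) * (prodBernoulli w).real (openConn b c : Set (Set (Sym2 V))) =
      ((prodBernoulli w).real ((openConn a c : Set (Set (Sym2 V))) ∩ (openConn b c : Set (Set (Sym2 V)))) * (prodBernoulli w).real (((openConn a b : Set (Set (Sym2 V))))ᶜ ∩ ((openConn a c : Set (Set (Sym2 V))))ᶜ ∩ ((openConn b c : Set (Set (Sym2 V))))ᶜ) -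
        (prodBernoulli w).real ((openConn a c : Set (Set (Sym2 V))) ∩ ((openConn b c : Set (Set (Sym2 V))))ᶜ) * (prodBernoulli w).real ((openConn b c : Set (Set (Sym2 V))) ∩ ((openConn a c : Set (Set (Sym2 V))))ᶜ)) +
      (prodBernoulli w).real ((openConn a c : Set (Set (Sym2 V))) ∩ (openConn b c : Set (Set (Sym2 V)))) * (prodBernoulli w).real ((openConn a b : Set (Set (Sym2 V))) ∩ ((openConn a c : Set (Set (Sym2 V))))ᶜ) := by
    have hs : (prodBernoulli w).real (((openConn a b : Set (Set (Sym2 V))))ᶜ ∩ ((openConn a c : Set (Set (Sym2 V))))ᶜ ∩ ((openConn b c : Set (Set (Sym2 V))))ᶜ) = 1 - (prodBernoulli w).real ((openConn a c : Set (Set (Sym2 V))) ∩ (openConn b c : Set (Set (Sym2 V)))) -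
        (prodBernoulli w).real ((openConn a c : Set (Set (Sym2 V))) ∩ ((openConn b c : Set (Set (Sym2 V))))ᶜ) - (prodBernoulli w).real ((openConn b c : Set (Set (Sym2 V))) ∩ ((openConn a c : Set (Set (Sym2 V))))ᶜ) -
        (prodBernoulli w).real ((openConn a b : Set (Set (Sym2 V))) ∩ ((openConn a c : Set (Set (Sym2 V))))ᶜ) := by linarith
    rw [hs, e1, e2]; ring
  rw [hcov]
  have step1 : (∏ v ∈ univ.filter (fun v => v ≠ c), (1 - (w s(c, v) : ℝ))) * ((prodBernoulli w).real ((openConn a c : Set (Set (Sym2 V))) ∩ (openConn b c : Set (Set (Sym2 V)))) * (prodBernoulli w).real (((openConn a b : Set (Set (Sym2 V))))ᶜ ∩ ((openConn a c : Set (Set (Sym2 V))))ᶜ ∩ ((openConn b c : Set (Set (Sym2 V))))ᶜ) -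
        (prodBernoulli w).real ((openConn a c : Set (Set (Sym2 V))) ∩ ((openConn b c : Set (Set (Sym2 V))))ᶜ) * (prodBernoulli w).real ((openConn b c : Set (Set (Sym2 V))) ∩ ((openConn a c : Set (Set (Sym2 V))))ᶜ)) ≤
      (∏ v ∈ univ.filter (fun v => v ≠ c), (1 - (w s(c, v) : ℝ))) * (prodBernoulli w).real (((openConn a c : Set (Set (Sym2 V))) ∩ (openConn b c : Set (Set (Sym2 V)))) ∩ {ω : Set (Sym2 V) | (openGraph (ω \ {e : Sym2 V | c ∈ e})).Reachable a b}) :=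
    (mul_le_mul_of_nonneg_left hT hβ0).trans
      (mul_le_mul_of_nonneg_left (mul_le_of_le_one_right hθ0 hs1) hβ0)
  have step2 : (∏ v ∈ univ.filter (fun v => v ≠ c), (1 - (w s(c, v) : ℝ))) * ((prodBernoulli w).real ((openConn a c : Set (Set (Sym2 V))) ∩ (openConn b c : Set (Set (Sym2 V)))) * (prodBernoulli w).real ((openConn a b : Set (Set (Sym2 V))) ∩ ((openConn a c : Set (Set (Sym2 V))))ᶜ)) ≤
      (∏ v ∈ univ.filter (fun v => v ≠ c), (1 - (w s(c, v) : ℝ))) * (prodBernoulli w).real ((openConn a b : Set (Set (Sym2 V))) ∩ ((openConn a c : Set (Set (Sym2 V))))ᶜ) :=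
    mul_le_mul_of_nonneg_left (mul_le_of_le_one_left hw0 hx1) hβ0
  nlinarith [step1, step2, hK]

/-- **Gladkov–Zimin Conjecture 6.3 holds on every class of weighted graphs whose hub has isolation probability ≥ β₀ > 0**,
in the printed `ε–δ` form with `δ = ε·β₀`: "For any `ε > 0` there exists `δ > 0` such that if `P(ab|c) < δ`, then
`P(abc) − P(ac)P(bc) < ε`" (arXiv:2404.08873, Conj. 6.3; Gladkov arXiv:2408.08457, Conj. 10.1), here for all finite `V`,
all `w : Sym2 V → [0,1]` with `∏_{v ≠ c} (1 − w(cv)) ≥ β₀`, and all distinct `a, b, c`.  (The conjecture without the isolation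
hypothesis remains open.) [cite: VandenbergHaggstromKahn2005, Thm. 1.4 (p. 7)] -/
theorem gz_conj63_of_hubIsolation {β₀ ε : ℝ} (hβ₀ : 0 < β₀) (hε : 0 < ε) :
    ∃ δ : ℝ, 0 < δ ∧ ∀ (w : Sym2 V → unitInterval) (a b c : V), a ≠ b → a ≠ c → b ≠ c →
      β₀ ≤ ∏ v ∈ univ.filter (fun v => v ≠ c), (1 - (w s(c, v) : ℝ)) →
      (prodBernoulli w).real ((openConn a b : Set (Set (Sym2 V))) ∩ ((openConn a c : Set (Set (Sym2 V))))ᶜ) < δ →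
      (prodBernoulli w).real ((openConn a c : Set (Set (Sym2 V))) ∩ (openConn b c : Set (Set (Sym2 V)))) - (prodBernoulli w).real (openConn a c : Set (Set (Sym2 V))) * (prodBernoulli w).real (openConn b c : Set (Set (Sym2 V))) < ε := by
  refine ⟨ε * β₀, mul_pos hε hβ₀, fun w a b c hab hac hbc hβ hw => ?_⟩
  have h := gz_cov_boundedHub w hab hac hbc
  have hβc : 0 < ∏ v ∈ univ.filter (fun v => v ≠ c), (1 - (w s(c, v) : ℝ)) := lt_of_lt_of_le hβ₀ hβ
  by_contra hcon
  push Not at hcon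
  have : ε * β₀ ≤ (∏ v ∈ univ.filter (fun v => v ≠ c), (1 - (w s(c, v) : ℝ))) *
      ((prodBernoulli w).real ((openConn a c : Set (Set (Sym2 V))) ∩ (openConn b c : Set (Set (Sym2 V)))) - (prodBernoulli w).real (openConn a c : Set (Set (Sym2 V))) * (prodBernoulli w).real (openConn b c : Set (Set (Sym2 V)))) :=
    calc ε * β₀ ≤ ε * ∏ v ∈ univ.filter (fun v => v ≠ c), (1 - (w s(c, v) : ℝ)) :=
          mul_le_mul_of_nonneg_left hβ hε.le
      _ = (∏ v ∈ univ.filter (fun v => v ≠ c), (1 - (w s(c, v) : ℝ))) * ε := mul_comm _ _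
      _ ≤ _ := mul_le_mul_of_nonneg_left hcon hβc.le
  linarith

end GZHub

end Summit.CriticalPhenomena.PercolationContinuityZ3.Theorems

end
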